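import Mathlib
import Summits.Ventures.PercRepro2.SwOutAll
import Summits.Ventures.PercRepro2.SwOutSeriesDefs
import Summits.Ventures.PercRepro2.SwOutSeriesContract
import Summits.Ventures.PercRepro2.SwOutSeriesContractCount
import Summits.Ventures.PercRepro2.SwOutSeriesDelete
import Summits.Ventures.PercRepro2.SwOutSeriesDeleteCount
import Summits.Ventures.PercRepro2.SwOutSeriesThm
import Summits.Ventures.PercRepro2.SwOutLeaf
import Summits.Ventures.PercRepro2.SwOutLeafThm
import Summits.Ventures.PercRepro2.SwOutReducible
import Summits.Ventures.PercRepro2.SwOutArmFlip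
import Summits.Ventures.PercRepro2.SwOutArms
import Summits.Ventures.PercRepro2.SwOutArmOrbit
import Summits.Ventures.PercRepro2.SwOutArmCube
import Summits.Ventures.PercRepro2.SwOutArmThm

/-!
# Row (SW) from the arm principle (blind cell PercRepro2, night-4 g10, 2026-08-25;
proofs/NIGHT4-G10.md §7)

The arm principle makes every region whose non-mark vertices all carry an outside edge a BASE
region of the series reduction (`reducible_of_outEdges`); hence row (SW), in its rigid form, holds
on every graph in which every vertex other than `l, h, o` is joined to `l` and `h` carries no loop
(`swAll_of_adj`, **`sw_of_adj`**) — in particular on every complete graph — and on every graph whose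
region `V ∖ {l}` reduces to such a base by series vertices and leaves.
-/

namespace Summit.Ventures.PercRepro2

namespace LocRows

open Hull

variable {V : Type*} {E : Type*} [Fintype E] [DecidableEq E]

open scoped Classical

variable {ends : E → Sym2 V} {l h o : V}

/-- A region whose non-mark vertices all carry an outside edge is a base region of the series
reduction. -/
theorem reducible_of_outEdges {U : Set V} (hl : l ∉ U) (hloop : ∀ e, ends e ≠ s(h, h))
    (hout : ∀ x ∈ U, x ≠ h → x ≠ o → ∃ e y, ends e = s(x, y) ∧ y ∉ U) :
    Reducible l h o ends U :=
  Reducible.base ends U fun ξ _ h𝓔 => rigidOK_of_outEdges (ξ := ξ) hl hloop hout h𝓔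

/-- **Row 2′SW-ALL on every graph in which every vertex other than `l, h, o` is joined to `l`** (no
loop at `h`). -/
theorem swAll_of_adj (hlh : l ≠ h) (hloop : ∀ e, ends e ≠ s(h, h))
    (hadj : ∀ x, x ≠ l → x ≠ h → x ≠ o → ∃ e, ends e = s(x, l)) : SwAll ends l h o := by
  refine swAll_of_reducible l h o hlh (reducible_of_outEdges (by simp) hloop ?_)
  intro x hx hxh hxo
  obtain ⟨e, he⟩ := hadj x (by simpa using hx) hxh hxo
  exact ⟨e, l, he, by simp⟩

/-- **Row (SW) on every graph in which every vertex other than `l, h, o` is joined to `l`** (no loop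
at `h`) — the complete graphs among them. -/
theorem sw_of_adj (hlh : l ≠ h) (hloop : ∀ e, ends e ≠ s(h, h))
    (hadj : ∀ x, x ≠ l → x ≠ h → x ≠ o → ∃ e, ends e = s(x, l)) : Sw ends l h o :=
  sw_of_swAll ends (swAll_of_adj hlh hloop hadj)

end LocRows

end Summit.Ventures.PercRepro2
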